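import Literature.Computability.QuantumComplexity.DyadicPhaseThresholds
import Literature.Computability.QuantumComplexity.CoreDescSLPCodes
import Literature.Computability.Complexity.CodeFPTableKit
import HarnessLib

/-!
# The constant expressions `constE w T` compile in polynomial time (closed form of the compiled program)

Topic `Literature/Computability/QuantumComplexity`; the S4 compiler input of the UNIFORMITY of Regev's sampler
([Regev2009, Lemma 3.14, proof]): the controlled-phase program `SLP.qftPhaseB k Tre Tim` contains the thresholds
`ltConstB k (k+1) T = (aE k < constE (k+1) T)` whose arithmetic expression `constE w T` (`DyadicPhaseThresholds.lean`) has a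
DATA-dependent shape (one `+ 2ⁱ` per set bit of `T`), so it is not an instance of a parametric program of `CoreDescSLPCodes.lean`.
We give the CLOSED FORM of its compiled register program — `copyIn r 0 0`, then for the `m`-th set bit `i` of `T` below `w` the
two instructions `setBit (r+2m+1) i`, `add (r+2m+2) (r+2m) (r+2m+1) 0`; result register `r + 2·#bits`, next `r + 2·#bits + 1`
(`SLP.constE_compile_eq`) — and compute it on codes with `filter`/`mapIdx`/`testBitNat` of the `CodeFP` algebra
(Arora–Barak §1.3): **`SLP.constE_compile_codeFP : (1ʷ, bin T, 1ʳ) ↦ (constE w T).compile Wd r`** (the width `Wd` is not read).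

Everything is proved; no named fact is introduced.

## References

* O. Regev, J. ACM 56(6) (2009), Lemma 3.14 (proof) [Regev2009].
* S. Arora, B. Barak, *Computational Complexity: A Modern Approach*, CUP 2009, §1.3, §6.2 [AroraBarak2009].
* M. A. Nielsen, I. L. Chuang, *Quantum Computation and Quantum Information*, CUP 2010, §5.1 [NielsenChuang2010].
-/

noncomputable section

namespace Literature.Computability.QuantumComplexity

open _root_.Computability Complexity Complexity.CodeFP

namespace SLP

/-- The two instructions of the `m`-th set bit `i`, registers from `r`. [folklore] -/
def constEStep (r m i : ℕ) : List Instr := [.setBit (r + 2 * m + 1) i, .add (r + 2 * m + 2) (r + 2 * m) (r + 2 * m + 1) 0]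

/-- The set bits of `T` below `w`, increasing. [folklore] -/
def setBits (w T : ℕ) : List ℕ := (List.range w).filter fun i => T.testBit i

/-- The closed form of the compiled constant. [folklore] -/
def constEOut (w T r : ℕ) : List Instr × ℕ × ℕ :=
  ([Instr.copyIn r 0 0] ++ ((setBits w T).mapIdx fun m i => constEStep r m i).flatten,
    r + 2 * (setBits w T).length, r + 2 * (setBits w T).length + 1)

/-- [folklore] -/
theorem setBits_succ (w T : ℕ) : setBits (w + 1) T = setBits w T ++ if T.testBit w then [w] else [] := by
  rw [setBits, List.range_succ, List.filter_append, setBits]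
  cases h : T.testBit w <;> simp [h]

/-- **The compiled constant in closed form.** [folklore] -/
theorem constE_compile_eq (Wd r : ℕ) : ∀ (w T : ℕ), (constE w T).compile Wd r = constEOut w T r
  | 0, T => by simp [constE, zeroE, AExpr.compile, constEOut, setBits]
  | w + 1, T => by
    have ih := constE_compile_eq Wd r w T
    unfold constE
    cases hT : T.testBit w
    · simp only [Bool.false_eq_true, ↓reduceIte]
      rw [ih, constEOut, constEOut, setBits_succ, hT]
      simp
    · simp only [↓reduceIte, AExpr.compile]
      rw [ih, constEOut, constEOut, setBits_succ, hT]
      simp only [↓reduceIte, List.mapIdx_append, List.flatten_append, List.length_append, List.length_singleton,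
        List.mapIdx_cons, List.mapIdx_nil, List.flatten_cons, List.flatten_nil, List.append_nil, zero_add, constEStep,
        List.append_assoc, List.cons_append, List.nil_append]
      refine Prod.ext rfl (Prod.ext (by ring) (by ring))

/-- The context code `(1ʷ, bin T, 1ʳ)`. [folklore] -/
abbrev constInE : ℕ × ℕ × ℕ → List Bool := pairE unE (pairE natE unE)

/-- The set bits on codes. [folklore] -/
theorem setBits_codeFP : CodeFP constInE (rawE natE) (fun t => setBits t.1 t.2.1) := by
  have hp : CodeFP (pairE constInE natE) bitE (fun q => q.1.2.1.testBit q.2) := (testBitNat.comp ((fst _ _).snd'.fst'.pair (snd _ _)) :)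
  exact ((filter hp).comp ((CodeFP.id _).pair (urange.comp (fst _ _)))).congr fun t => by simp [setBits]

/-- The step on codes: context, index `m` (binary), bit `i` (binary). [folklore] -/
theorem constEStep_codeFP : CodeFP (pairE constInE (pairE natE natE)) (rawE AJLCore.instrE) (fun q => constEStep q.1.2.2 q.2.1 q.2.2) := by
  let E := pairE constInE (pairE natE natE)
  have hr : CodeFP E natE (fun q => q.1.2.2) := (natOfUn.comp (fst _ _).snd'.snd' :)
  have hm : CodeFP E natE (fun q => q.2.1) := ((snd _ _).fst' :)
  have hi : CodeFP E natE (fun q => q.2.2) := ((snd _ _).snd' :)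
  have h2m : CodeFP E natE (fun q => q.1.2.2 + 2 * q.2.1) := (natAdd.comp (hr.pair (natMul.comp ((const _ 2).pair hm))) :)
  have h1 : CodeFP E natE (fun q => q.1.2.2 + 2 * q.2.1 + 1) := (natAdd.comp (h2m.pair (const _ 1)) :)
  have h2 : CodeFP E natE (fun q => q.1.2.2 + 2 * q.2.1 + 2) := (natAdd.comp (h2m.pair (const _ 2)) :)
  have hA : CodeFP E AJLCore.instrE (fun q => Instr.setBit (q.1.2.2 + 2 * q.2.1 + 1) q.2.2) := (AJLCore.instr_setBit h1 hi :)
  have hB : CodeFP E (rawE AJLCore.instrE) (fun q => [Instr.add (q.1.2.2 + 2 * q.2.1 + 2) (q.1.2.2 + 2 * q.2.1) (q.1.2.2 + 2 * q.2.1 + 1) 0]) :=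
    ((rawSingleton AJLCore.instrE).comp (AJLCore.instr_add h2 h2m h1 (const _ 0)) :)
  exact (((rawCons AJLCore.instrE).comp (hA.pair hB)) :).congr fun q => by simp [constEStep]

/-- **`(1ʷ, bin T, 1ʳ) ↦ (constE w T).compile Wd r` in polynomial time** (any `Wd`). [cite: AroraBarak2009, §1.3]
[cite: NielsenChuang2010, §5.1] -/
theorem constE_compile_codeFP (Wd : ℕ) : CodeFP constInE AJLCore.outAE (fun t => (constE t.1 t.2.1).compile Wd t.2.2) := by
  have hS := setBits_codeFP
  have hr : CodeFP constInE unE (fun t => t.2.2) := ((snd _ _).snd' :)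
  have hprog : CodeFP constInE (rawE AJLCore.instrE)
      (fun t => [Instr.copyIn t.2.2 0 0] ++ ((setBits t.1 t.2.1).mapIdx fun m i => constEStep t.2.2 m i).flatten) :=
    ((rawAppend AJLCore.instrE).comp (((rawSingleton AJLCore.instrE).comp (AJLCore.instr_copyIn (natOfUn.comp hr) (const _ 0) (const _ 0))).pair
      ((flatten AJLCore.instrE).comp ((mapIdx constEStep_codeFP).comp ((CodeFP.id _).pair hS)))) :)
  have hlen : CodeFP constInE unE (fun t => t.2.2 + 2 * (setBits t.1 t.2.1).length) :=
    (unAdd.comp (hr.pair ((unMulConst 2).comp ((ulength natE).comp hS))) :)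
  exact ((hprog.pair (hlen.pair (unSucc.comp hlen))) :).congr fun t => by rw [constE_compile_eq]; rfl

end SLP

end Literature.Computability.QuantumComplexity

end
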